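import Literature.MathematicalPhysics.QuantumFieldTheory.Balaban1983to89.B8TowerBondsPrinted
import HarnessLib

/-!
# Route «BalabanUVNodes», cluster K4 «SpineRates» — node N16 = NE3: AT THE PINNED ALL-TORUS MEMBERS, PRINT'S (1.31)∕𝔅_k CONSTRAINT-BOND CLASS
# `towerBondsP` (dag-n05-d D0, p582555) IS THE CANONICAL CLASS `i.Λb m j = {j = m}` — the coming N05 carrier edition «(1.42) `C137` at `towerBondsP`»
# is INVISIBLE on N16's keys (37ᴴ ∕ 38ᴴ ∕ 40ᴮ at `zdGF3` pinned)

Cell `pub-ymgap`, width seat `pub-ymgap-dag-n16-w2` (g0; director-ym №197 ∕ HUMAN RULING D-0149), node N16.  `--kind proof --supports stmt-QuantumFields-20544 --as helper`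
(K3⁷ `SpineGivenEndpointR13SepCoPH`).  `bears_on: R4∕N16 · edge N05 → N16`.

WHY (decision context, bus l.24261 ∕ l.24287 ∕ l.≈24346, 2026-08-27).  This seat's LOCATED-Q1 and the answers of dag-n05-d g10 ∕ dag-n05-c g12: node N05's record
slot `Node00.B8LeafOfRecordSubBH θ λ` has its [Balaban1985RegularSpaces] Proposition-3 conjunct refuted AS TYPED at the lawful interior-shell member of `IdxB8SubB θ`
(certificate = dag-n05-d INTENT-3 `B8Prop3ShellModeVacuity`), because the member's (1.42) hypothesis `C137` reads the NARROW class `i.Λb = towerBonds` (no crossing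
bonds); the repair of record is a CARRIER EDITION — `C137` (and the `|B₁|` datum) read at print's class `B8TowerBondsPrinted.towerBondsP L i.Ω (i.Λs m) j` ((1.31) p. 82:
inner bonds with box in `Ω_j` AND crossing bonds with box in `Ω_{j−1}`).  Node N16's keys of record (`…N16OfEdgesAllTorusAtRecord13CoPH` 37ᴴ, `…N16OfSocketsAllTorusAtRecord13CoPH`
38ᴴ, `…N16OfThm33LettersAllTorusAtRecord13CoPH` 40ᴮ) read `B8.Thm4Body` ∕ `B8.Prop3Body` ∕ the five sockets at n05-a's `zdGF3` at the PINNED all-torus members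
`(∀ j, i.Ω j = univ) ∧ (∀ m j, i.Λs m j = {j = m}) ∧ (∀ m j, i.Λb m j = {j = m}) ∧ i.η = L^{−k}`.  THIS FILE records the one fact the re-keying question needs: at a
pinned member print's class IS the canonical class, level by level — at the top level every bond is inner with box in `ℤᵈ` (`towerBondsP_univ_self`), and below the top
level every disjunct of `towerBondsP` demands an end-point in `Λ_j = ∅`.  So a carrier edition replacing `i.Λb m j` by `towerBondsP L i.Ω (i.Λs m) j` in `C137` (or in any
bond-class-reading field) leaves every pinned member's fields unchanged, and N16's 37ᴴ ∕ 38ᴴ ∕ 40ᴮ faces transfer by rewriting.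

WHAT THIS FILE PROVES (kernel bookkeeping, 0 `def`, 0 `sorry`; any `d`, any `L`):
* `towerBondsP_pinned_top` : `towerBondsP L i.Ω (i.Λs m) m = univ`;
* `towerBondsP_pinned_of_ne` : `j ≠ m → towerBondsP L i.Ω (i.Λs m) j = ∅`;
* ★ `towerBondsP_pinned_eq_lamB` : `towerBondsP L i.Ω (i.Λs m) j = i.Λb m j` for all `m j`;
* `towerBondsP_pinned_eq_lamB_fun` : the same as an equality of the two class FUNCTIONS `(fun m j => towerBondsP L i.Ω (i.Λs m) j) = i.Λb`;
* `towerBonds_pinned_eq_lamB` : law №12's class agrees too (`towerBonds L i.Ω (i.Λs m) j = i.Λb m j`), so at the pinned members the three classes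
  (canonical ∕ law №12 ∕ print's) coincide.
Stated over the explicit pin hypotheses `hΩ hΛs hΛb` (no subtype), so every pinned sub-index in the tree (`…AllTorusPinned`, F47 §1) instantiates them by projection.

HONEST FRAMING.  Lattice bookkeeping over two landed definitions; no estimate; nothing of Bałaban asserted; the carrier edition itself is node N05's ∕ node00-def's
(not typed here); **N16 ∕ NE3 NOT discharged**; count-neutral (typed 28∕28 · discharged 5∕27 UNMOVED); one finite four-torus at fixed ε — NOT ℝ⁴, NOT infinite volume,
NOT OS, NOT a mass gap, NOT Clay.  No `sorry`, no `def`, no `instance`, no `notation`.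
-/

set_option autoImplicit false

namespace Summit.QuantumFields.YangMills.BalabanUVNodes.N16PinnedPrintedBondClass

open Literature.MathematicalPhysics.QuantumFieldTheory.Balaban1983to89
open B7Prop1Explicit
open B8LeafModelZd (ZdIdx)
open B8IdxB8LawsB (towerBonds mem_towerBonds_iff)
open B8TowerBondsPrinted (towerBondsP mem_towerBondsP_iff towerBondsP_univ_self)

variable {d L : ℕ}

/-- **AT THE TOP LEVEL OF A PINNED MEMBER PRINT'S CLASS IS EVERY BOND**: with `Ω_m = ℤᵈ` and `Λ_m = ℤᵈ` every level-`m` bond is inner with box in `ℤᵈ`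
(`B8TowerBondsPrinted.towerBondsP_univ_self` BY NAME). [cite: Balaban1985RegularSpaces, (1.31) p.82, p.77 («we admit Ω_j = T_η»)] -/
theorem towerBondsP_pinned_top (i : ZdIdx d L) (hΩ : ∀ j, i.Ω j = Set.univ) (hΛs : ∀ m j, i.Λs m j = {_y | j = m}) (m : ℕ) :
    towerBondsP L i.Ω (i.Λs m) m = Set.univ := by
  refine towerBondsP_univ_self L (hΩ m) ?_
  rw [hΛs m m]
  ext y
  simp

/-- **BELOW (OR OFF) THE TOP LEVEL OF A PINNED MEMBER PRINT'S CLASS IS EMPTY**: each of the three disjuncts of `towerBondsP` (inner; crossing; mirrored crossing)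
demands an end-point of the bond in `Λ_j`, and `Λ_j = ∅` for `j ≠ m`. [cite: Balaban1985RegularSpaces, (1.31) p.82, (1.12) p.78] -/
theorem towerBondsP_pinned_of_ne (i : ZdIdx d L) (hΛs : ∀ m j, i.Λs m j = {_y | j = m}) {m j : ℕ} (hjm : j ≠ m) :
    towerBondsP L i.Ω (i.Λs m) j = ∅ := by
  ext c
  simp only [Set.mem_empty_iff_false, iff_false]
  intro hc
  rw [mem_towerBondsP_iff] at hc
  have hempty : ∀ y : Site d, y ∉ i.Λs m j := fun y hy => by
    rw [hΛs m j] at hy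
    exact hjm hy
  rcases hc with ⟨-, h1, -⟩ | ⟨-, ⟨j', -, -, h2⟩ | ⟨j', -, h1, -⟩⟩
  · exact hempty _ h1
  · exact hempty _ h2
  · exact hempty _ h1

/-- ★ **AT A PINNED ALL-TORUS MEMBER PRINT'S (1.31)∕𝔅_k CLASS IS THE CANONICAL CLASS, LEVEL BY LEVEL**: `towerBondsP L i.Ω (i.Λs m) j = i.Λb m j` for every
truncation `m` and level `j` — so a carrier edition reading (1.42) `C137` (or the `|B₁|` datum) at `towerBondsP` instead of `i.Λb` changes nothing at the members node
N16 keys on. [cite: Balaban1985RegularSpaces, (1.31) p.82, (1.42) p.83, p.77] -/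
theorem towerBondsP_pinned_eq_lamB (i : ZdIdx d L) (hΩ : ∀ j, i.Ω j = Set.univ) (hΛs : ∀ m j, i.Λs m j = {_y | j = m})
    (hΛb : ∀ m j, i.Λb m j = {_c | j = m}) (m j : ℕ) :
    towerBondsP L i.Ω (i.Λs m) j = i.Λb m j := by
  by_cases hjm : j = m
  · subst hjm
    rw [towerBondsP_pinned_top i hΩ hΛs j, hΛb j j]
    ext c
    simp
  · rw [towerBondsP_pinned_of_ne i hΛs hjm, hΛb m j]
    ext c
    simp [hjm]

/-- The same as an equality of CLASS FUNCTIONS: print's class of the pinned member's towers IS the member's own class `i.Λb`.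
[cite: Balaban1985RegularSpaces, (1.31) p.82 (bookkeeping)] -/
theorem towerBondsP_pinned_eq_lamB_fun (i : ZdIdx d L) (hΩ : ∀ j, i.Ω j = Set.univ) (hΛs : ∀ m j, i.Λs m j = {_y | j = m})
    (hΛb : ∀ m j, i.Λb m j = {_c | j = m}) :
    (fun m j => towerBondsP L i.Ω (i.Λs m) j) = i.Λb :=
  funext fun m => funext fun j => towerBondsP_pinned_eq_lamB i hΩ hΛs hΛb m j

/-- **… AND LAW №12's CLASS AGREES AS WELL** (`B8IdxB8LawsB.towerBonds`, the class of node N05's sub-index of record): at a pinned member the canonical class, law №12's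
class and print's class coincide — top level = all bonds (box in `ℤᵈ`, both ends in `Λ_m = ℤᵈ`), other levels empty (every disjunct needs an end-point in `Λ_j = ∅`).
[cite: Balaban1985RegularSpaces, (1.31) p.82, p.86 («𝔅_k»), p.77] -/
theorem towerBonds_pinned_eq_lamB (i : ZdIdx d L) (hΩ : ∀ j, i.Ω j = Set.univ) (hΛs : ∀ m j, i.Λs m j = {_y | j = m})
    (hΛb : ∀ m j, i.Λb m j = {_c | j = m}) (m j : ℕ) :
    towerBonds L i.Ω (i.Λs m) j = i.Λb m j := by
  ext c
  rw [mem_towerBonds_iff, hΛb m j]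
  by_cases hjm : j = m
  · subst hjm
    simp [hΩ j, hΛs j j]
  · have hempty : ∀ y : Site d, y ∉ i.Λs m j := fun y hy => by
      rw [hΛs m j] at hy
      exact hjm hy
    simp only [Set.mem_setOf_eq, hjm, iff_false, not_and]
    intro _ h
    rcases h with ⟨h1, -⟩ | ⟨j', -, -, h2⟩ | ⟨j', -, h1, -⟩
    · exact hempty _ h1
    · exact hempty _ h2
    · exact hempty _ h1

end Summit.QuantumFields.YangMills.BalabanUVNodes.N16PinnedPrintedBondClass
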